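import Summits.Ventures.LatticeQCDFlow.TrivializingMaps.PlaquetteHaarMoments
import Summits.Ventures.LatticeQCDFlow.TrivializingMaps.FisherZeroRadiusBound
import Summits.Ventures.LatticeQCDFlow.TrivializingMaps.WilsonPinching

/-!
HONEST FRAMING: exact (Metropolis-corrected) sampling algorithms for lattice gauge theory; figures
of merit are autocorrelation/cost numbers at stated couplings and volumes; no continuum-physics
claim.
# WilsonVarianceExtensive — at β = 0 distinct plaquettes are UNCORRELATED, `Var_{D[U]}(S_W) =
# m₂(n)·#plaquettes`, and EVERY finite-volume `SU(n)` Wilson partition function has a Fisher zero in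
# ONE FIXED DISC `|s| < R₀(n)` — so Lüscher's volume-uniform radius is `≤ R₀(n)` (lean-2 GEN-6, ours)

Venture-side (OURS); cell `lqcd-flow`, unit `pub-lqcd-lean-2-g6`, 2026-08-22; sequel of `PlaquetteHaarMoments`.

* §1 lattice bookkeeping (`L ≥ 2`): `plaquetteHolonomy_mulSingle_of_ne`, `…_mulSingle_second`,
  and `exists_forward_link_fresh` (for two DIFFERENT plaquettes one of the two forward links of the
  first is not a link of the second — a 16-case check).
* §2 **`integral_re_trace_mul_re_trace_eq_zero`** — for `p ≠ p'`, `n ≥ 2`, `L ≥ 2`: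
  `E_{D[U]}[Re tr U_p · Re tr U_{p'}] = 0` (left invariance of `D[U]` at the fresh link under the `n`
  central elements `e^{2πik/n}·1`, summed over `k`: `∑_k e^{2πik/n} = 0`).
* §3 **`wilson_variance_eq`** — `Var_{D[U]}(S_W ∘ ι) = m₂(n) · #plaquettes`,
  `m₂(n) = ∫_{SU(n)}(Re tr)² > 0` (Mathlib `variance_fun_sum` + §2 + `PlaquetteHaarMoments`).
* §4 **`wilson_exists_fisherZero_norm_lt_uniform`** — with `R₀(n) := max 1 (256(2n+1)/m₂(n))`, for
  EVERY `d ≥ 2` and EVERY `L ≥ 2` the volume-`L` Wilson partition function `Z_L(s) = ∫D[U]e^{-sS_W}`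
  has a zero with `|s₀| < R₀(n)` (`FisherZeroRadiusBound` with `|S_W| ≤ 2n·#plaq`); hence
  **`wilson_theoremA_radius_le_uniform`** — every radius `ρ` of a THEOREM-A-type volume-uniform
  geometric gradient bound satisfies `ρ ≤ R₀(n)`: the finite-volume Fisher zeros do not escape to
  infinity, and the strong-coupling (Lüscher) series cannot converge volume-uniformly beyond `R₀(n)`.
NOT CLAIMED: the value of `m₂(n)` (classically `1` for `n = 2`, `½` for `n ≥ 3`); `L = 1`; `β ≠ 0`.
-/

open MeasureTheory ProbabilityTheory Filter Topology Complex Set Metric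
open Literature.MathematicalPhysics.QuantumFieldTheory
open Literature.MathematicalPhysics.QuantumFieldTheory.Luscher2010
open Literature.MathematicalPhysics.QuantumFieldTheory.WilsonFlow (coeConfig continuous_coeConfig)
open scoped Matrix Matrix.Norms.Frobenius ContDiff

namespace Summit.Ventures.LatticeQCDFlow.TrivializingMaps

/-! ## §1 Lattice bookkeeping -/

section Lattice

variable {d L : ℕ} {G : Type*} [Group G]

/-- A link different from the four links of a plaquette does not enter its holonomy. [folklore] -/
theorem plaquetteHolonomy_mulSingle_of_ne [DecidableEq (Edge d L)] (U : GaugeConfig d L G)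
    {e : Edge d L} (x : Site d L) (i j : Fin d) (h1 : e ≠ (x, i)) (h2 : e ≠ (x.shift i, j))
    (h3 : e ≠ (x.shift j, i)) (h4 : e ≠ (x, j)) (h : G) :
    plaquetteHolonomy (Pi.mulSingle e h * U) x i j = plaquetteHolonomy U x i j := by
  simp only [plaquetteHolonomy, Pi.mul_apply, Pi.mulSingle_eq_of_ne h1.symm,
    Pi.mulSingle_eq_of_ne h2.symm, Pi.mulSingle_eq_of_ne h3.symm, Pi.mulSingle_eq_of_ne h4.symm,
    one_mul]

/-- A CENTRAL element on the second forward link `(x+î, j)` multiplies the holonomy of `(x,i,j)`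
(`i ≠ j`, `L ≥ 2`). [folklore] -/
theorem plaquetteHolonomy_mulSingle_second [NeZero L] [DecidableEq (Edge d L)] (hL : 2 ≤ L)
    (U : GaugeConfig d L G) (x : Site d L) {i j : Fin d} (hij : i ≠ j) {h : G}
    (hc : ∀ g : G, g * h = h * g) :
    plaquetteHolonomy (Pi.mulSingle (x.shift i, j) h * U) x i j =
      h * plaquetteHolonomy U x i j := by
  have h1 : ((x, i) : Edge d L) ≠ (x.shift i, j) := fun e => hij (congrArg Prod.snd e)
  have h3 : ((x.shift j, i) : Edge d L) ≠ (x.shift i, j) := fun e => hij (congrArg Prod.snd e)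
  have h4 : ((x, j) : Edge d L) ≠ (x.shift i, j) := fun e =>
    (site_shift_ne_self_of_two_le hL x i) (congrArg Prod.fst e).symm
  simp only [plaquetteHolonomy, Pi.mul_apply, Pi.mulSingle_eq_same, Pi.mulSingle_eq_of_ne h1,
    Pi.mulSingle_eq_of_ne h3, Pi.mulSingle_eq_of_ne h4, one_mul]
  rw [← mul_assoc (U (x, i)) h, hc (U (x, i))]
  simp only [mul_assoc]

/-- **For two different plaquettes, one of the two forward links of the first is not a link of the
second** (`L ≥ 2`; a 16-case check on the torus). [folklore] -/
theorem exists_forward_link_fresh [NeZero L] (hL : 2 ≤ L) {x x' : Site d L} {i j i' j' : Fin d}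
    (hij : i < j) (hij' : i' < j') (hne : ¬ (x = x' ∧ i = i' ∧ j = j')) :
    ∃ e : Edge d L, (e = (x, i) ∨ e = (x.shift i, j)) ∧ e ≠ (x', i') ∧ e ≠ (x'.shift i', j') ∧
      e ≠ (x'.shift j', i') ∧ e ≠ (x', j') := by
  haveI : Fact (1 < L) := ⟨by omega⟩
  have hsne : ∀ (y : Site d L) (k : Fin d), y.shift k ≠ y := site_shift_ne_self_of_two_le hL
  -- evaluating a site identity at one coordinate
  have hss : ∀ (y : Site d L) (k l : Fin d), (y.shift k).shift l = y.shift l → False := by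
    intro y k l h
    have h1 := congrArg (fun z : Site d L => z k) h
    simp [Site.shift, Pi.single_apply] at h1
  have hss0 : ∀ (y : Site d L) (k l : Fin d), k ≠ l → (y.shift k).shift l = y → False := by
    intro y k l hkl h
    have h1 := congrArg (fun z : Site d L => z k) h
    simp [Site.shift, hkl] at h1
  by_cases hA : ((x, i) : Edge d L) = (x', i')
  · rw [Prod.mk.injEq] at hA
    obtain ⟨hx, hi⟩ := hA
    refine ⟨(x.shift i, j), Or.inr rfl, ?_, ?_, ?_, ?_⟩ <;> intro h <;>
      rw [Prod.mk.injEq] at h <;> obtain ⟨h1, h2⟩ := h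
    · omega
    · exact hne ⟨hx, hi, h2⟩
    · omega
    · rw [hx] at h1
      exact hsne x' i h1
  by_cases hB : ((x, i) : Edge d L) = (x'.shift i', j')
  · rw [Prod.mk.injEq] at hB
    obtain ⟨hx, hi⟩ := hB
    refine ⟨(x.shift i, j), Or.inr rfl, ?_, ?_, ?_, ?_⟩ <;> intro h <;>
      rw [Prod.mk.injEq] at h <;> obtain ⟨h1, h2⟩ := h <;> omega
  by_cases hC : ((x, i) : Edge d L) = (x'.shift j', i')
  · rw [Prod.mk.injEq] at hC
    obtain ⟨hx, hi⟩ := hC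
    refine ⟨(x.shift i, j), Or.inr rfl, ?_, ?_, ?_, ?_⟩ <;> intro h <;>
      rw [Prod.mk.injEq] at h <;> obtain ⟨h1, h2⟩ := h
    · omega
    · subst hi
      rw [hx] at h1
      exact hss x' j' i h1
    · omega
    · subst hi
      rw [hx] at h1
      exact hss0 x' j' i (by omega) h1
  by_cases hD : ((x, i) : Edge d L) = (x', j')
  · rw [Prod.mk.injEq] at hD
    obtain ⟨hx, hi⟩ := hD
    refine ⟨(x.shift i, j), Or.inr rfl, ?_, ?_, ?_, ?_⟩ <;> intro h <;>
      rw [Prod.mk.injEq] at h <;> obtain ⟨h1, h2⟩ := h <;> omega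
  exact ⟨(x, i), Or.inl rfl, hA, hB, hC, hD⟩

end Lattice

/-! ## §2 Distinct plaquettes are uncorrelated under the trivial theory -/

section Decorrelation

variable {d L n : ℕ} [NeZero L]

/-- The central elements `ζ^k · 1 ∈ SU(n)`, `ζ = e^{2πi/n}`: membership. [folklore] -/
theorem rootOfUnity_smul_one_mem (hn : 1 ≤ n) (k : ℕ) :
    (Complex.exp (2 * Real.pi * I / n) ^ k) • (1 : Matrix (Fin n) (Fin n) ℂ) ∈
      Matrix.specialUnitaryGroup (Fin n) ℂ := by
  set ζ : ℂ := Complex.exp (2 * Real.pi * I / n) with hζdef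
  have hn0 : (n : ℂ) ≠ 0 := by exact_mod_cast (show n ≠ 0 by omega)
  have hζn : ζ ^ n = 1 := by
    rw [hζdef, ← Complex.exp_nat_mul, mul_div_cancel₀ _ hn0, Complex.exp_two_pi_mul_I]
  have hζu : ‖ζ‖ = 1 := by
    have : ‖ζ‖ ^ n = 1 := by rw [← norm_pow, hζn, norm_one]
    exact (pow_eq_one_iff_of_nonneg (norm_nonneg _) (by omega)).mp this
  have hζku : ‖ζ ^ k‖ = 1 := by rw [norm_pow, hζu, one_pow]
  rw [Matrix.mem_specialUnitaryGroup_iff]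
  refine ⟨?_, ?_⟩
  · rw [Matrix.mem_unitaryGroup_iff, Matrix.star_eq_conjTranspose, Matrix.conjTranspose_smul,
      Matrix.conjTranspose_one, Matrix.smul_mul, one_mul, smul_smul, Complex.star_def,
      Complex.mul_conj, Complex.normSq_eq_norm_sq, hζku]
    simp
  · rw [Matrix.det_smul, Matrix.det_one, mul_one, Fintype.card_fin, ← pow_mul, mul_comm, pow_mul,
      hζn, one_pow]

/-- `∑_{k<n} ζ^k = 0` for `ζ = e^{2πi/n}`, `n ≥ 2`. [folklore] -/
theorem sum_rootOfUnity_pow_eq_zero (hn : 2 ≤ n) :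
    ∑ k ∈ Finset.range n, Complex.exp (2 * Real.pi * I / n) ^ k = 0 := by
  set ζ : ℂ := Complex.exp (2 * Real.pi * I / n) with hζdef
  have hn0 : (n : ℂ) ≠ 0 := by exact_mod_cast (show n ≠ 0 by omega)
  have hζn : ζ ^ n = 1 := by
    rw [hζdef, ← Complex.exp_nat_mul, mul_div_cancel₀ _ hn0, Complex.exp_two_pi_mul_I]
  have hζ1 : ζ ≠ 1 := by
    intro h
    rw [hζdef, Complex.exp_eq_one_iff] at h
    obtain ⟨k, hk⟩ := h
    have h2 : (2 * Real.pi * I : ℂ) ≠ 0 := by simp [Real.pi_ne_zero, Complex.I_ne_zero]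
    have h3 : (2 * Real.pi * I : ℂ) = k * (2 * Real.pi * I) * n := by
      have := congrArg (fun z : ℂ => z * n) hk
      simpa [div_mul_cancel₀ _ hn0] using this
    have h4 : (2 * Real.pi * I : ℂ) * 1 = (2 * Real.pi * I) * (k * n) := by
      rw [mul_one]; linear_combination h3
    have hkn : (k : ℂ) * n = 1 := (mul_left_cancel₀ h2 h4).symm
    have hkz : k * (n : ℤ) = 1 := by exact_mod_cast hkn
    have hn1 : (n : ℤ) = 1 := Int.eq_one_of_mul_eq_one_left (by positivity) hkz
    omega
  rw [geom_sum_eq hζ1, hζn, sub_self, zero_div]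

/-- **Distinct plaquettes are uncorrelated at β = 0**: for `p ≠ p'` (`n ≥ 2`, `L ≥ 2`),
`∫ D[U] Re tr U_p · Re tr U_{p'} = 0`. [ours] -/
theorem integral_re_trace_mul_re_trace_eq_zero (hL : 2 ≤ L) (hn : 2 ≤ n) {p p' : Plaquette d L}
    (hpp' : p ≠ p') :
    ∫ U, (((plaquetteHolonomy U p.1 p.2.1.1 p.2.1.2 : Matrix.specialUnitaryGroup (Fin n) ℂ) :
        Matrix (Fin n) (Fin n) ℂ)).trace.re *
      (((plaquetteHolonomy U p'.1 p'.2.1.1 p'.2.1.2 : Matrix.specialUnitaryGroup (Fin n) ℂ) :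
        Matrix (Fin n) (Fin n) ℂ)).trace.re
      ∂(trivialMeasure (Matrix.specialUnitaryGroup (Fin n) ℂ) d L) = 0 := by
  classical
  set D := trivialMeasure (Matrix.specialUnitaryGroup (Fin n) ℂ) d L with hD
  haveI : D.IsMulLeftInvariant := by rw [hD]; unfold trivialMeasure; infer_instance
  haveI : IsProbabilityMeasure D := by rw [hD]; unfold trivialMeasure; infer_instance
  obtain ⟨x, ⟨⟨i, j⟩, hij⟩⟩ := p
  obtain ⟨x', ⟨⟨i', j'⟩, hij'⟩⟩ := p'
  simp only at hij hij' ⊢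
  have hne : ¬ (x = x' ∧ i = i' ∧ j = j') := by
    rintro ⟨rfl, rfl, rfl⟩; exact hpp' rfl
  obtain ⟨e, he, h1, h2, h3, h4⟩ := exists_forward_link_fresh hL hij hij' hne
  set ζ : ℂ := Complex.exp (2 * Real.pi * I / n) with hζdef
  -- the observable and its transformation under the central element on the fresh link
  set X : GaugeConfig d L (Matrix.specialUnitaryGroup (Fin n) ℂ) → ℂ := fun U =>
    ((plaquetteHolonomy U x i j : Matrix.specialUnitaryGroup (Fin n) ℂ) :
      Matrix (Fin n) (Fin n) ℂ).trace with hXdef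
  set Y : GaugeConfig d L (Matrix.specialUnitaryGroup (Fin n) ℂ) → ℝ := fun U =>
    (((plaquetteHolonomy U x' i' j' : Matrix.specialUnitaryGroup (Fin n) ℂ) :
      Matrix (Fin n) (Fin n) ℂ)).trace.re with hYdef
  have hcentral : ∀ (k : ℕ) (g : Matrix.specialUnitaryGroup (Fin n) ℂ),
      g * ⟨ζ ^ k • 1, rootOfUnity_smul_one_mem (by omega) k⟩ =
        ⟨ζ ^ k • 1, rootOfUnity_smul_one_mem (by omega) k⟩ * g := fun k g => by
    apply Subtype.ext
    show (g : Matrix (Fin n) (Fin n) ℂ) * (ζ ^ k • 1) =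
      (ζ ^ k • 1) * (g : Matrix (Fin n) (Fin n) ℂ)
    rw [Matrix.mul_smul, mul_one, Matrix.smul_mul, one_mul]
  have hshift : ∀ (k : ℕ) (U : GaugeConfig d L (Matrix.specialUnitaryGroup (Fin n) ℂ)),
      X (Pi.mulSingle e ⟨ζ ^ k • 1, rootOfUnity_smul_one_mem (by omega) k⟩ * U) = ζ ^ k * X U ∧
      Y (Pi.mulSingle e ⟨ζ ^ k • 1, rootOfUnity_smul_one_mem (by omega) k⟩ * U) = Y U := by
    intro k U
    constructor
    · have hhol : plaquetteHolonomy (Pi.mulSingle e ⟨ζ ^ k • 1, rootOfUnity_smul_one_mem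
          (by omega) k⟩ * U) x i j = ⟨ζ ^ k • 1, rootOfUnity_smul_one_mem (by omega) k⟩ *
          plaquetteHolonomy U x i j := by
        rcases he with rfl | rfl
        · exact plaquetteHolonomy_mulSingle_left hL U x (ne_of_lt hij) _
        · exact plaquetteHolonomy_mulSingle_second hL U x (ne_of_lt hij) (hcentral k)
      simp only [hXdef, hhol]
      show ((ζ ^ k • (1 : Matrix (Fin n) (Fin n) ℂ)) * _).trace = _
      rw [Matrix.smul_mul, one_mul, Matrix.trace_smul, smul_eq_mul]
    · simp only [hYdef, plaquetteHolonomy_mulSingle_of_ne U x' i' j' h1 h2 h3 h4]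
  -- integrability
  have hXc : Continuous X := by
    simp only [hXdef]
    refine (continuous_subtype_val.comp ?_).matrix_trace
    unfold plaquetteHolonomy; fun_prop
  have hYc : Continuous Y := by
    simp only [hYdef]
    refine Complex.continuous_re.comp (continuous_subtype_val.comp ?_).matrix_trace
    unfold plaquetteHolonomy; fun_prop
  have hint : Integrable (fun U => X U * (Y U : ℂ)) D :=
    integrable_trivialMeasure_of_continuous_complex (hXc.mul (continuous_ofReal.comp hYc))
  -- invariance for each `k`, summed over `k`: `n ∫ X Y = (∑ ζ^k) ∫ X Y = 0`
  have hk : ∀ k : ℕ, ∫ U, X U * (Y U : ℂ) ∂D = ζ ^ k * ∫ U, X U * (Y U : ℂ) ∂D := by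
    intro k
    have key := integral_mul_left_eq_self (μ := D) (fun U => X U * (Y U : ℂ))
      (Pi.mulSingle e ⟨ζ ^ k • 1, rootOfUnity_smul_one_mem (by omega) k⟩)
    have hfun : (fun U => X (Pi.mulSingle e ⟨ζ ^ k • 1, rootOfUnity_smul_one_mem (by omega) k⟩
        * U) * (Y (Pi.mulSingle e ⟨ζ ^ k • 1, rootOfUnity_smul_one_mem (by omega) k⟩ * U) : ℂ))
        = fun U => ζ ^ k * (X U * (Y U : ℂ)) := by
      funext U
      rw [(hshift k U).1, (hshift k U).2, mul_assoc]
    rw [hfun, integral_const_mul] at key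
    exact key.symm
  have hsum : (n : ℂ) * ∫ U, X U * (Y U : ℂ) ∂D = 0 := by
    calc (n : ℂ) * ∫ U, X U * (Y U : ℂ) ∂D
        = ∑ k ∈ Finset.range n, ∫ U, X U * (Y U : ℂ) ∂D := by simp
      _ = ∑ k ∈ Finset.range n, ζ ^ k * ∫ U, X U * (Y U : ℂ) ∂D :=
          Finset.sum_congr rfl fun k _ => hk k
      _ = (∑ k ∈ Finset.range n, ζ ^ k) * ∫ U, X U * (Y U : ℂ) ∂D := by
          rw [Finset.sum_mul]
      _ = 0 := by rw [sum_rootOfUnity_pow_eq_zero hn, zero_mul]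
  have hn0 : (n : ℂ) ≠ 0 := by exact_mod_cast (show n ≠ 0 by omega)
  have hI : ∫ U, X U * (Y U : ℂ) ∂D = 0 := (mul_eq_zero.mp hsum).resolve_left hn0
  -- real part
  have hre : ∫ U, (X U).re * Y U ∂D = (∫ U, X U * (Y U : ℂ) ∂D).re := by
    rw [complex_re_integral_eq hint]
    refine integral_congr_ae (ae_of_all _ fun U => ?_)
    simp [Complex.mul_re]
  rw [hre, hI, Complex.zero_re]

end Decorrelation

/-! ## §3 The β = 0 variance of the Wilson action is `m₂(n) · #plaquettes` -/

section Variance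

variable {d L n : ℕ} [NeZero L]

/-- **`Var_{D[U]}(S_W ∘ ι) = m₂(n) · #plaquettes`** for `n ≥ 2`, `L ≥ 2`, every `d`. [ours] -/
theorem wilson_variance_eq (hL : 2 ≤ L) (hn : 2 ≤ n) :
    variance (fun U => ambWilsonAction (coeConfig U))
        (trivialMeasure (Matrix.specialUnitaryGroup (Fin n) ℂ) d L) =
      (∫ g, ((g : Matrix (Fin n) (Fin n) ℂ)).trace.re ^ 2
          ∂(haarProbability (Matrix.specialUnitaryGroup (Fin n) ℂ))) *
        Fintype.card (Plaquette d L) := by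
  set D := trivialMeasure (Matrix.specialUnitaryGroup (Fin n) ℂ) d L with hD
  haveI : IsProbabilityMeasure D := by rw [hD]; unfold trivialMeasure; infer_instance
  set m₂ := ∫ g, ((g : Matrix (Fin n) (Fin n) ℂ)).trace.re ^ 2
    ∂(haarProbability (Matrix.specialUnitaryGroup (Fin n) ℂ)) with hm₂
  -- the plaquette observables
  set Xp : Plaquette d L → GaugeConfig d L (Matrix.specialUnitaryGroup (Fin n) ℂ) → ℝ :=
    fun p U => (((plaquetteHolonomy U p.1 p.2.1.1 p.2.1.2 :
      Matrix.specialUnitaryGroup (Fin n) ℂ) : Matrix (Fin n) (Fin n) ℂ)).trace.re with hXpdef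
  have hXc : ∀ p, Continuous (Xp p) := fun p => by
    simp only [hXpdef]
    refine Complex.continuous_re.comp (continuous_subtype_val.comp ?_).matrix_trace
    unfold plaquetteHolonomy; fun_prop
  have hXb : ∀ p U, |Xp p U| ≤ n := fun p U => by
    have h := Literature.RepresentationTheory.CompactGroups.CompactGroup.abs_re_trace_le_card
      (StrongCoupling.defRep n) continuous_subtype_val (plaquetteHolonomy U p.1 p.2.1.1 p.2.1.2)
    rw [Fintype.card_fin] at h
    simpa [StrongCoupling.defRep] using h
  have hXm : ∀ p, MemLp (Xp p) 2 D := fun p =>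
    MemLp.of_bound (integrable_trivialMeasure_of_continuous (hXc p)).aestronglyMeasurable n
      (ae_of_all _ fun U => by rw [Real.norm_eq_abs]; exact hXb p U)
  -- `S_W ∘ ι = n·P − ∑_p Xp`
  have hS : (fun U : GaugeConfig d L (Matrix.specialUnitaryGroup (Fin n) ℂ) =>
      ambWilsonAction (coeConfig U)) =
      fun U => -(∑ p, Xp p U) + n * Fintype.card (Plaquette d L) := by
    funext U
    rw [StrongCoupling.ambWilsonAction_coeConfig]
    unfold wilsonAction
    simp only [hXpdef, StrongCoupling.defRep, Submonoid.subtype_apply, Finset.sum_sub_distrib,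
      Finset.sum_const, Finset.card_univ, nsmul_eq_mul]
    ring
  have hsumc : Continuous fun U : GaugeConfig d L (Matrix.specialUnitaryGroup (Fin n) ℂ) =>
      -(∑ p, Xp p U) := (continuous_finsetSum _ fun p _ => hXc p).neg
  rw [hS, variance_add_const (integrable_trivialMeasure_of_continuous hsumc).aestronglyMeasurable,
    variance_fun_neg, variance_fun_sum hXm]
  -- covariances: diagonal `m₂`, off-diagonal `0`
  have hcov : ∀ p q : Plaquette d L, cov[Xp p, Xp q; D] = if p = q then m₂ else 0 := by
    intro p q
    rw [covariance_eq_sub (hXm p) (hXm q)]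
    have hmean : ∀ r : Plaquette d L, ∫ U, Xp r U ∂D = 0 := fun r =>
      integral_re_trace_plaquetteHolonomy_eq_zero hL hn r.1 (ne_of_lt r.2.2)
    split_ifs with hpq
    · subst hpq
      rw [hmean p, mul_zero, sub_zero]
      have := integral_sq_re_trace_plaquetteHolonomy (d := d) (n := n) hL p.1 (ne_of_lt p.2.2)
      simp only [Pi.mul_apply, ← sq]
      exact this
    · rw [hmean p, zero_mul, sub_zero]
      simp only [Pi.mul_apply]
      exact integral_re_trace_mul_re_trace_eq_zero hL hn hpq
  simp only [hcov, Finset.sum_ite_eq, Finset.mem_univ, if_true, Finset.sum_const, Finset.card_univ,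
    nsmul_eq_mul]
  ring

end Variance

/-! ## §4 A Fisher zero in one fixed disc for every volume; THEOREM A's radius is bounded -/

section Uniform

variable {d L n : ℕ} [NeZero L]

/-- **VOLUME-UNIFORM FISHER ZERO.**  For `n ≥ 2`, `d ≥ 2` and EVERY `L ≥ 2` the `SU(n)` Wilson
partition function `Z_L(s) = ∫ D[U] e^{-s S_W}` has a zero `s₀` with `|s₀| < R₀(n)`,
`R₀(n) = max 1 (256(2n+1)/m₂(n))`, `m₂(n) = ∫_{SU(n)} (Re tr)²`. [ours] -/
theorem wilson_exists_fisherZero_norm_lt_uniform (hd : 2 ≤ d) (hn : 2 ≤ n) (hL : 2 ≤ L) :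
    ∃ s₀ : ℂ, ‖s₀‖ < max 1 (256 * (2 * n + 1) /
        ∫ g, ((g : Matrix (Fin n) (Fin n) ℂ)).trace.re ^ 2
          ∂(haarProbability (Matrix.specialUnitaryGroup (Fin n) ℂ))) ∧
      complexMGF (fun U => -ambWilsonAction (coeConfig U))
        (trivialMeasure (Matrix.specialUnitaryGroup (Fin n) ℂ) d L) s₀ = 0 := by
  set m₂ := ∫ g, ((g : Matrix (Fin n) (Fin n) ℂ)).trace.re ^ 2
    ∂(haarProbability (Matrix.specialUnitaryGroup (Fin n) ℂ)) with hm₂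
  set P : ℝ := (Fintype.card (Plaquette d L) : ℝ) with hPdef
  set R : ℝ := max 1 (256 * (2 * n + 1) / m₂) with hRdef
  have hm : 0 < m₂ := haarSqReTrace_pos (by omega)
  have hP : 1 ≤ P := by
    rw [hPdef]; exact_mod_cast WilsonPinching.one_le_card_plaquette hd
  have hR1 : 1 ≤ R := le_max_left _ _
  have hR0 : 0 < R := by linarith
  have hRm : 256 * (2 * n + 1) / m₂ ≤ R := le_max_right _ _
  refine exists_actionZ_eq_zero_norm_lt (d := d) (L := L) (n := n) contDiff_ambWilsonAction
    (b := 2 * n * P) (fun U => by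
      rw [hPdef, StrongCoupling.ambWilsonAction_coeConfig]
      exact WilsonPinching.abs_wilsonAction_le (StrongCoupling.defRep n) continuous_subtype_val U)
    hR0 ?_
  rw [wilson_variance_eq hL hn, ← hm₂, ← hPdef]
  have hb : |2 * (n : ℝ) * P| = 2 * n * P := abs_of_nonneg (by positivity)
  rw [hb]
  -- `128 (2nP R + 1)/R² ≤ 128 (2n+1) P / R < m₂ P`
  have h1 : 128 * (2 * n * P * R + 1) / R ^ 2 ≤ 128 * (2 * n + 1) * P / R := by
    rw [div_le_div_iff₀ (by positivity) hR0]
    have : 2 * n * P * R + 1 ≤ (2 * n + 1) * P * R := by nlinarith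
    nlinarith
  have h2 : 128 * (2 * n + 1) * P / R < m₂ * P := by
    rw [div_lt_iff₀ hR0]
    have h3 : 256 * (2 * n + 1) ≤ R * m₂ := by rwa [div_le_iff₀ hm] at hRm
    nlinarith
  linarith

/-- **THEOREM A's volume-uniform radius is bounded by `R₀(n)`**: every `ρ > 0` admitting a
volume-uniform geometric gradient bound for the Lüscher series of the `SU(n)` Wilson action
(`d ≥ 2`, `n ≥ 2`) satisfies `ρ ≤ max 1 (256(2n+1)/m₂(n))` (COROLLARY F′ with the uniform zero).
[ours] -/
theorem wilson_theoremA_radius_le_uniform (hd : 2 ≤ d) (hn : 2 ≤ n) {ρ C : ℝ} (hρ : 0 < ρ)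
    (hA : ∀ (L : ℕ) [NeZero L] (B : SuBasis n) (Sk : ℕ → AmbConfig d L n → ℝ) (c : ℕ → ℝ),
      (∀ k, ContDiff ℝ ∞ (Sk k)) → IsLuscherSeries B ambWilsonAction Sk c →
      ∀ (k : ℕ) (U : GaugeConfig d L (Matrix.specialUnitaryGroup (Fin n) ℂ)) (e : Edge d L)
        (a : B.ι), |linkDeriv e (B.T a) (Sk k) (coeConfig U)| ≤ C * ρ⁻¹ ^ k)
    (B : SuBasis n) :
    ρ ≤ max 1 (256 * (2 * n + 1) /
        ∫ g, ((g : Matrix (Fin n) (Fin n) ℂ)).trace.re ^ 2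
          ∂(haarProbability (Matrix.specialUnitaryGroup (Fin n) ℂ))) := by
  haveI : NeZero (2 : ℕ) := ⟨by norm_num⟩
  obtain ⟨s₀, hs₀, hz⟩ :=
    wilson_exists_fisherZero_norm_lt_uniform (d := d) (L := 2) (n := n) hd hn le_rfl
  exact (wilson_radius_le_norm_of_actionZ_eq_zero hρ hA B 2 hz).trans hs₀.le

end Uniform

end Summit.Ventures.LatticeQCDFlow.TrivializingMaps
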